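import Literature.NumberTheory.EllipticCurves.QuadraticTwistLocalDataAtTwoPadicGlueProofs
import HarnessLib

/-!
# Discharge of `BarriosEtAl2025_quadraticTwist_two_of_goodReduction` and of
# `BarriosEtAl2025.localTamagawaNumber_quadraticTwist_two_mem_of_goodReduction`

`Proofs` file (theorems only, no definitions, no named facts) in topic
`NumberTheory/EllipticCurves`: the `_holds` theorems of the two named facts vendoring
Barrios–Roy–Sahajpal–Tallana–Tobin–Wiersema, *Local data of elliptic curves under quadratic twist*,
Res. Number Theory 11 (2025), Thm. 5.1, rows `R = I₀` of the two `ℚ₂` tables (arXiv:2501.03209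
pp. 15–16) — `QuadraticTwistLocalDataAtTwo` (local form, p251509) and
`BarriosEtAl2025/QuadraticTwistAtTwo` (global Tamagawa form, p251464, through the landed bridge
`BarriosEtAl2025.localTamagawaNumber_quadraticTwist_two_mem_of_goodReduction_of_local`).

## The proof (Silverman's Tate algorithm run literally over `ℤ₂`)

Let `E / ℚ₂` be elliptic with good reduction and `I` the integral minimal model (unit `Δ`,
`isUnit_Δ_integralModel_of_hasGoodReduction`); `2 = ϖ ε` in `ℤ₂`.
* `a₁(I) ∈ ℤ₂ˣ` (ordinary): `I ≅ V = ⟨1, a₂, 0, a₄, a₆⟩` with `4 ∣ a₄`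
  (`exists_smul_ordinaryNormalForm`); `d ≡ 3 (4)`: `E^{(d)} ≅ ⟨2, d b₂ - 1, 0, 16d²a₄, 64d³a₆⟩`,
  family A, **`I₄*`**, `c ∈ {2, 4}`; `d ≡ 2 (4)`: `E^{(d)} ≅ ⟨0, d b₂, 0, 16d²a₄, 64d³a₆⟩`,
  family B, **`I₈*`**, `c ∈ {2, 4}` (`kodairaSymbolOfMinimal_twistGoodOrdinary_three/_two`).
* `a₁(I) ∈ 𝔪` (supersingular): `I ≅ V = ⟨0, a₂, a₃, a₄, a₆⟩` (`exists_smul_a₁_eq_zero`);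
  `d ≡ 3 (4)`: `E^{(d)} ≅ ⟨0, 4da₂, 8a₃, 16d²a₄, 16(d³b₆ - a₃²)⟩`, Step 10, **`II*`**, `c = 1`;
  `d ≡ 2 (4)`: `E^{(d)} = ⟨0, da₂, 0, d²a₄, d³b₆/4⟩`, Step 3, **`II`**, `c = 1`
  (`kodairaSymbolOfMinimal_twistGoodSupersingular_three/_two`).
* `d ≡ 1 (4)`: good reduction persists, `I₀`, `c = 1`
  (`kodairaSymbol_and_localTamagawaNumber_quadraticTwist_of_one_mod_four`).
In every additive case the explicit model is minimal because the literal algorithm does not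
return `I₀` on it (`TateAlgorithmExitMinimalityProofs`), and `c` is read off by the tree's
`LocalIndex` theorems (`kodairaSymbol_and_localTamagawaNumber_of_model_padic`).

## Main results

* `Literature.NumberTheory.EllipticCurves.BarriosEtAl2025_quadraticTwist_two_of_goodReduction_holds`;
* `Literature.NumberTheory.EllipticCurves.BarriosEtAl2025.localTamagawaNumber_quadraticTwist_two_mem_of_goodReduction_holds`.

## References

* A. J. Barrios, M. Roy, N. Sahajpal, D. Tallana, B. Tobin, H. Wiersema, *Local data of elliptic
  curves under quadratic twist*, Res. Number Theory 11 (2025), no. 3, Thm. 5.1 with the rows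
  `R = I₀` of the §5 tables for `v(d) = 0` and `v(d) = 1` (arXiv:2501.03209 pp. 15–16), §5.1
  Case 1, §5.2 Case 1. [BarriosEtAl2025]
* J. H. Silverman, *Advanced Topics in the Arithmetic of Elliptic Curves*, GTM 151 (1994), IV.9.4
  (Tate's algorithm) and Table 4.1. [SilvermanATAEC1994]
-/

noncomputable section

open scoped Classical

open IsLocalRing IsDedekindDomain
open IsDiscreteValuationRing hiding maximalIdeal

namespace Literature.NumberTheory.EllipticCurves

namespace TwistGoodTwo

open Literature.NumberTheory.DiophantineGeometry Literature.NumberTheory.DiophantineGeometry.TateAlgorithm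

/-- Transport of a model identity along `C₁ • E = V ⊗ ℚ₂`: a change of variables taking
`(V ⊗ ℚ₂)^{(d)}` to `M ⊗ ℚ₂` yields one taking `E^{(d)}` to `M ⊗ ℚ₂`
(`quadraticTwist_smul`: `(C₁ • E)^{(d)} = (u; d r, 0, 0) • E^{(d)}`). Silverman *AEC* X.5 Cor. 5.4.
[folklore] -/
private theorem exists_smul_quadraticTwist_eq_baseChange (E : WeierstrassCurve ℚ_[2])
    (V M : WeierstrassCurve ℤ_[2]) (C₁ : WeierstrassCurve.VariableChange ℚ_[2])
    (hVE : C₁ • E = V.baseChange ℚ_[2]) (d : ℚ_[2])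
    (hM : ∃ C : WeierstrassCurve.VariableChange ℚ_[2],
      C • ((V.baseChange ℚ_[2]).quadraticTwist d) = M.baseChange ℚ_[2]) :
    ∃ C : WeierstrassCurve.VariableChange ℚ_[2],
      C • (E.quadraticTwist d) = M.baseChange ℚ_[2] := by
  obtain ⟨C, hC⟩ := hM
  refine ⟨C * ⟨C₁.u, d * C₁.r, 0, 0⟩, ?_⟩
  rw [mul_smul, ← WeierstrassCurve.quadraticTwist_smul, hVE, hC]

/-- The integral minimal model of an elliptic curve with good reduction over `ℚ₂`, brought into
one of the two normal forms of `QuadraticTwistGoodReductionCharTwoProofs`: a `ℤ₂`-model `V` of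
`E` with unit discriminant and either `a₁ = 1, a₃ = 0, 4 ∣ a₄` (ordinary) or `a₁ = 0`
(supersingular). Silverman *AEC* VII.1, III.1 Table 3.1. [folklore] -/
private theorem exists_normalForm_of_hasGoodReduction {ε : ℤ_[2]} (hε : (2 : ℤ_[2]) = uniformizer ℤ_[2] * ε)
    (hεu : IsUnit ε) (E : WeierstrassCurve ℚ_[2]) [E.IsElliptic]
    (hgood : (E.minimal ℤ_[2]).HasGoodReduction ℤ_[2]) :
    ∃ (V : WeierstrassCurve ℤ_[2]) (C₁ : WeierstrassCurve.VariableChange ℚ_[2]),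
      C₁ • E = V.baseChange ℚ_[2] ∧ IsUnit V.Δ ∧
        ((V.a₁ = 1 ∧ V.a₃ = 0 ∧ (4 : ℤ_[2]) ∣ V.a₄) ∨ V.a₁ = 0) := by
  haveI := hgood
  set I := (E.minimal ℤ_[2]).integralModel ℤ_[2] with hIdef
  have hI : I.baseChange ℚ_[2] = (E.exists_isMinimal ℤ_[2]).choose • E :=
    WeierstrassCurve.baseChange_integralModel_eq ℤ_[2] (E.minimal ℤ_[2])
  have hΔI : IsUnit I.Δ := isUnit_Δ_integralModel_of_hasGoodReduction (E.minimal ℤ_[2])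
  have key : ∀ D : WeierstrassCurve.VariableChange ℤ_[2],
      (D.map (algebraMap ℤ_[2] ℚ_[2]) * (E.exists_isMinimal ℤ_[2]).choose) • E =
        (D • I).baseChange ℚ_[2] ∧ IsUnit (D • I).Δ := fun D ↦ by
    refine ⟨?_, ?_⟩
    · rw [mul_smul, ← hI, WeierstrassCurve.baseChange, WeierstrassCurve.baseChange,
        WeierstrassCurve.map_variableChange]
    · rw [WeierstrassCurve.variableChange_Δ]
      exact ((D.u⁻¹).isUnit.pow 12).mul hΔI
  by_cases ha : IsUnit I.a₁
  · obtain ⟨D, h1, h3, h4⟩ := exists_smul_ordinaryNormalForm I ha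
    exact ⟨D • I, _, (key D).1, (key D).2, Or.inl ⟨h1, h3, h4⟩⟩
  · have hdvd : uniformizer ℤ_[2] ∣ I.a₁ := (not_isUnit_iff_dvd irreducible_uniformizer _).mp ha
    obtain ⟨D, -, h1⟩ := exists_smul_a₁_eq_zero hε hεu I hdvd
    exact ⟨D • I, _, (key D).1, (key D).2, Or.inr h1⟩

/-- **Discharge of the named fact `BarriosEtAl2025_quadraticTwist_two_of_goodReduction`**
(Barrios–Roy–Sahajpal–Tallana–Tobin–Wiersema 2025, Thm. 5.1, rows `R = I₀` of the `ℚ₂` tables for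
`v(d) = 0` and `v(d) = 1`): for an elliptic curve `E / ℚ₂` with good reduction and an integer `d`,
the quadratic twist `E^{(d)}` has Kodaira symbol `I₀` and `c = 1` if `d ≡ 1 (mod 4)`; Kodaira
symbol `I₄*` (ordinary `E`) or `II*` (supersingular `E`) and `c ∈ {1, 2, 4}` if `d ≡ 3 (mod 4)`;
Kodaira symbol `I₈*` or `II` and `c ∈ {1, 2, 4}` if `d ≡ 2 (mod 4)` — by Silverman's Tate
algorithm run literally over `ℤ₂` on the explicit models of
`QuadraticTwistGoodReductionCharTwoProofs` / `…SupersingularProofs`, their minimality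
(`TateAlgorithmExitMinimalityProofs`) and the tree's local-index theorems.
[cite: BarriosEtAl2025, Thm. 5.1 with the rows R = I₀ of the §5 tables for v(d) = 0 and v(d) = 1 (arXiv pp. 15–16); §5.1 Case 1, §5.2 Case 1]
[cite: SilvermanATAEC1994, IV.9.4 (PDF pp. 344–346) and Table 4.1] -/
theorem _root_.Literature.NumberTheory.EllipticCurves.BarriosEtAl2025_quadraticTwist_two_of_goodReduction_holds :
    BarriosEtAl2025_quadraticTwist_two_of_goodReduction := by
  intro E _ hgood d
  haveI := perfectField_residueField_padicInt
  obtain ⟨ε, hεu, hε⟩ := exists_isUnit_two_eq_uniformizer_mul_padicInt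
  obtain ⟨V, C₁, hVE, hVΔ, hform⟩ := exists_normalForm_of_hasGoodReduction hε hεu E hgood
  have h124 : ∀ {c : ℕ}, (c = 2 ∨ c = 4) → c ∈ ({1, 2, 4} : Set ℕ) := by
    rintro c (rfl | rfl) <;> simp
  have h1mem : (1 : ℕ) ∈ ({1, 2, 4} : Set ℕ) := by simp
  refine ⟨fun hd1 ↦ ?_, fun hd3 ↦ ?_, fun hd2 ↦ ?_⟩
  · -- `d ≡ 1 (mod 4)`
    obtain ⟨k, hk⟩ : ∃ k : ℤ, d = 4 * k + 1 :=
      ⟨d / 4, by have h := hd1; unfold Int.ModEq at h; omega⟩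
    exact kodairaSymbol_and_localTamagawaNumber_quadraticTwist_of_one_mod_four hε E V hVΔ C₁ hVE hk
  · -- `d ≡ 3 (mod 4)`
    obtain ⟨k, hk⟩ : ∃ k : ℤ, d = 4 * k + 3 :=
      ⟨d / 4, by have h := hd3; unfold Int.ModEq at h; omega⟩
    have hd0 : (d : ℚ_[2]) ≠ 0 := by exact_mod_cast (show (d : ℤ) ≠ 0 by omega)
    haveI := WeierstrassCurve.isElliptic_quadraticTwist E hd0
    rcases hform with ⟨h1, h3, h4⟩ | h1
    · obtain ⟨hK, -, -⟩ := kodairaSymbolOfMinimal_twistGoodOrdinary_three hε hεu V h1 h3 h4 hVΔ hk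
      obtain ⟨C, hC⟩ := exists_smul_quadraticTwist_eq_baseChange E V _ C₁ hVE (d : ℚ_[2])
        (smul_quadraticTwist_eq_modelThree hε hεu V h1 h3 d)
      obtain ⟨hk', -, hc⟩ := kodairaSymbol_and_localTamagawaNumber_of_model_padic _ _ C hC
        (by rw [hK]; decide)
      exact ⟨Or.inl (hk'.trans hK), h124 (hc 3 hK)⟩
    · obtain ⟨hK, -, -⟩ := kodairaSymbolOfMinimal_twistGoodSupersingular_three hε hεu V h1 hVΔ hk
      obtain ⟨C, hC⟩ := exists_smul_quadraticTwist_eq_baseChange E V _ C₁ hVE (d : ℚ_[2])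
        (smul_quadraticTwist_eq_modelThree' hε hεu V h1 d)
      obtain ⟨hk', hc, -⟩ := kodairaSymbol_and_localTamagawaNumber_of_model_padic _ _ C hC
        (by rw [hK]; decide)
      exact ⟨Or.inr (hk'.trans hK), hc (Or.inr hK) ▸ h1mem⟩
  · -- `d ≡ 2 (mod 4)`
    obtain ⟨k, hk⟩ : ∃ k : ℤ, d = 4 * k + 2 :=
      ⟨d / 4, by have h := hd2; unfold Int.ModEq at h; omega⟩
    have hd0 : (d : ℚ_[2]) ≠ 0 := by exact_mod_cast (show (d : ℤ) ≠ 0 by omega)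
    haveI := WeierstrassCurve.isElliptic_quadraticTwist E hd0
    rcases hform with ⟨h1, h3, h4⟩ | h1
    · obtain ⟨hK, -, -⟩ := kodairaSymbolOfMinimal_twistGoodOrdinary_two hε hεu V h1 h3 h4 hVΔ hk
      obtain ⟨C, hC⟩ := exists_smul_quadraticTwist_eq_baseChange E V _ C₁ hVE (d : ℚ_[2])
        (smul_quadraticTwist_eq_modelTwo hε hεu V h1 h3 d)
      obtain ⟨hk', -, hc⟩ := kodairaSymbol_and_localTamagawaNumber_of_model_padic _ _ C hC
        (by rw [hK]; decide)
      exact ⟨Or.inl (hk'.trans hK), h124 (hc 7 hK)⟩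
    · have hd₁ : (2 * k + 1 : ℤ) = 2 * k + 1 := rfl
      obtain ⟨hK, -, -⟩ := kodairaSymbolOfMinimal_twistGoodSupersingular_two hε hεu V h1 hVΔ hd₁
      have hdd : ((d : ℤ) : ℚ_[2]) = ((2 * (2 * k + 1) : ℤ) : ℚ_[2]) := by rw [hk]; push_cast; ring
      obtain ⟨C, hC⟩ := exists_smul_quadraticTwist_eq_baseChange E V _ C₁ hVE (d : ℚ_[2])
        ⟨1, by rw [one_smul, hdd]; exact quadraticTwist_eq_modelTwo' hε hεu V h1 (2 * k + 1)⟩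
      obtain ⟨hk', hc, -⟩ := kodairaSymbol_and_localTamagawaNumber_of_model_padic _ _ C hC
        (by rw [hK]; decide)
      exact ⟨Or.inr (hk'.trans hK), hc (Or.inl hK) ▸ h1mem⟩

/-- **Discharge of the named fact
`BarriosEtAl2025.localTamagawaNumber_quadraticTwist_two_mem_of_goodReduction`** (Barrios et al.
2025, Thm. 5.1, rows `R = I₀`): for `E / ℚ` with good reduction at `2` and any `d ≠ 0`, the local
Tamagawa number at `2` of (any model of) the quadratic twist `E^{(d)}` is `1`, `2` or `4` — the
local fact `BarriosEtAl2025_quadraticTwist_two_of_goodReduction_holds` through the tree's bridge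
`BarriosEtAl2025.localTamagawaNumber_quadraticTwist_two_mem_of_goodReduction_of_local`
(reduction of `d ∈ ℚˣ` to an integer `≢ 0 (mod 4)` modulo squares, model independence of `c₂`).
[cite: BarriosEtAl2025, Thm. 5.1 with Tables tab:localdata-dodd / tab:localdata-deven, rows R = I₀ (arXiv:2501.03209 pp. 15–16)] -/
theorem _root_.Literature.NumberTheory.EllipticCurves.BarriosEtAl2025.localTamagawaNumber_quadraticTwist_two_mem_of_goodReduction_holds :
    BarriosEtAl2025.localTamagawaNumber_quadraticTwist_two_mem_of_goodReduction :=
  BarriosEtAl2025.localTamagawaNumber_quadraticTwist_two_mem_of_goodReduction_of_local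
    BarriosEtAl2025_quadraticTwist_two_of_goodReduction_holds

end TwistGoodTwo

end Literature.NumberTheory.EllipticCurves

end
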